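import Summits.QuantumFields.YangMills.Theorems.BalabanUVNodesN15TwoSpacingGluingNeumannKnitRightCube
import HarnessLib

/-!
# THE GLUING STEP AT TWO LATTICE SPACINGS, LIII: THE ADJOINT REMAINDER `R̃` OF THE COVER's PARAMETRIX ON THE DOUBLED TORUS AT BOTH SPACINGS — `R̃ ≤ (κ∕L^m)e^{−δ|y−y′|_T}`,
# HYPOTHESIS-FREE: rows 7 and 8 of FILE 50's bundle for the glued `U ≡ 1` family (dag-n15-c g13, FILE 95; N15 = NE2, s1 «background-layer OPERATOR ingredient»)

Cell `pub-ymgap`, seat `pub-ymgap-dag-n15-c` (R134 (a); HUMAN RULING D-0062), generation 13.  `bears_on: R4∕N15 · K3⁸ SpineGivenEndpointR13SepCoPHV (stmt-QuantumFields-27366)`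
(KEY MAP v2).  Filed `--supports stmt-QuantumFields-27366 --as helper` — COUNT-NEUTRAL.  Theorems only (0 `def`, 0 `sorry`).  Imports BY NAME FILE 94 `…NeumannKnitRightCube` (the cube row;
through it FILE 91, FILES 45–80, dag-n15-a N-IIn); nothing in the tree is modified.

WHAT.  ★ `maj₂_weaken`, `maj₀_weaken` (constant ∕ rate weakening), ★ `rightRemainderConst_le` (`Θ_w ≤ κ₀∕w` for `w ≥ 1`), ★★★ **`hasMaj_remainderL_knit_pair`** — for odd `L ≥ 3`, `a > 0` there are
`δ > 0`, `κ ≥ 0` such that for ALL `m`, `k ≥ 1`, `r`, on the doubled torus `MP (paramsOf d L (m+1) k hL)` with FILE 70's cover (`knitH`, `knitG`):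
  `remainderL Δ_a h G ≤ (κ∕L^m)·e^{−δ|y−y′|_T}` at the coarse spacing `L^{−k}` AND at the fine spacing `L^{−(k+r)}`
— FILE 94's cube rows fed with dag-n15-a's letters at ONE rate `min δ₀ δ⁺ δ⁻` (`ineq110_114_pair` + `hasMaj_gOp_of_ineq`; N-IIn `hasMaj_rightGrad_pair`, `hasMaj_rightBgrad_pair` read through
`symbOp_sD_eq` ∕ `symbOp_sTinv_sub_one_eq`; part 41 `hasMaj_landauRe`), then FILE 94 `remainderL_cut` and FILE 57 `hasMaj_remainderL_out` (output overlap `(2L)^{d+1}`, `|h| ≤ 1`).  These are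
the `hRL`-rows 1–2 of FILE 92 `gluedLetters_knit_of_rightRows` ∕ FILE 93 `ne2PlusOperator_knit_of_rightRows` IN THEIR DISPLAYED SHAPE (`κ_L∕(L:ℝ)^m`); only the two-grid defect `𝔇(R̃′, R̃)`
(row 14) remains displayed — its local part needs N-IIo∕N-IIr `(c)⁺` (dag-n15-a: `hSrc` hypothesis-free, INTENT N-IIp∕q∕r) and its nonlocal part a source-side letter of `𝔇` behind the cube.

HONEST FRAMING ∕ LIMITS.  Block-majorant bookkeeping over LANDED rows; `U ≡ 1` doubled-cube torus MODEL (cube = half torus: circular as an estimate); nothing of [B5]∕[B6]∕[B9] asserted.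
NE2⁺ NOT PRINTED, NOT proved; N15 NOT discharged; counts of record UNMOVED (typed 28∕28 · discharged 5∕27); one finite 𝕋⁴ at fixed ε per index — NOT infinite volume, NOT OS on ℝ⁴, NOT a
mass gap, NOT Clay; R4 closes `BalabanLadder.UV` only.  Restate-immune (no Theses import).
-/

noncomputable section

namespace Summit.QuantumFields.YangMills.BalabanUVNodes.N15.Gluing

open Real
open Literature.MathematicalPhysics.QuantumFieldTheory.Balaban1983to89
open Literature.MathematicalPhysics.QuantumFieldTheory.Balaban1983to89.B5Prop11Plancherel (Tor fine unitVec)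
open Literature.MathematicalPhysics.QuantumFieldTheory.Balaban1983to89.B11SectG (BlockNorm HasMaj RowSum hasMaj_zero)
open Literature.MathematicalPhysics.QuantumFieldTheory.Balaban1983to89.B6Prop26Gluing (mulOp mulOp_apply ind ind_nonneg ind_le_one)
open Literature.MathematicalPhysics.QuantumFieldTheory.Balaban1983to89.B6RandomWalk (Triangle254)
open Literature.MathematicalPhysics.QuantumFieldTheory.Balaban1983to89.B6UnitTorusCarrier (unitTorusGeo triangle254_unitTorusGeo rowSum_unitTorusGeo unitTorusGeo_dist_nonneg
  unitTorusGeo_dist_self unitTorusGeo_dist_symm)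
open Literature.MathematicalPhysics.QuantumFieldTheory.Balaban1983to89.B5SiteBridgeP12 (MP)
open Literature.MathematicalPhysics.QuantumFieldTheory.King1986.Torus (blockOf tdistT tdistT_nonneg)
open Summit.QuantumFields.YangMills.BalabanUVNodes.N15.VectorPiece (bshiftEquiv bshiftEquiv_apply bshiftEquiv_symm_apply kingPrV blkFine)
open Summit.QuantumFields.YangMills.BalabanUVNodes.N15.BackgroundLayer (fgrad fgradAdj bgrad fgrad_apply fgradAdj_apply bgrad_apply symbOp_sD_eq symbOp_sTinv_sub_one_eq)
open Summit.QuantumFields.YangMills.BalabanUVNodes.N15.TwoGrid (paramsOf deltaOp gOp neumannCubeG symOp symbOp sD sTinv chiCube cubeBlocks landauRe ineq110_114_pair hasMaj_gOp_of_ineq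
  hasMaj_landauRe hasMaj_rightGrad_pair hasMaj_rightBgrad_pair)

variable {d : ℕ}

/-! ## The cover's adjoint remainder `R̃` on the doubled torus at both spacings -/

section Knit

/-- Two-sided constant ∕ rate weakening. [folklore] -/
theorem maj₂_weaken {L : ℕ} {M : Fin (d + 1) → ℕ} [∀ μ, NeZero (M μ)] {kk : ℕ} {S : Set (Tor M)} {c C δ δ' : ℝ} (hc : c ≤ C) (hC : 0 ≤ C) (hδ : δ' ≤ δ) (y y' : Tor M) :
    ind (g := unitTorusGeo L kk M) S y * ind (g := unitTorusGeo L kk M) S y' * (c * Real.exp (-(δ * tdistT M y y'))) ≤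
      ind (g := unitTorusGeo L kk M) S y * ind (g := unitTorusGeo L kk M) S y' * (C * Real.exp (-(δ' * tdistT M y y'))) :=
  mul_le_mul_of_nonneg_left (mul_le_mul hc (Real.exp_le_exp.mpr (by nlinarith [tdistT_nonneg M y y'])) (Real.exp_nonneg _) hC)
    (mul_nonneg (ind_nonneg _ _) (ind_nonneg _ _))

/-- Plain constant ∕ rate weakening. [folklore] -/
theorem maj₀_weaken {M : Fin (d + 1) → ℕ} [∀ μ, NeZero (M μ)] {c C δ δ' : ℝ} (hc : c ≤ C) (hC : 0 ≤ C) (hδ : δ' ≤ δ) (y y' : Tor M) :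
    c * Real.exp (-(δ * tdistT M y y')) ≤ C * Real.exp (-(δ' * tdistT M y y')) :=
  mul_le_mul hc (Real.exp_le_exp.mpr (by nlinarith [tdistT_nonneg M y y'])) (Real.exp_nonneg _) hC

/-- The `w`-dependence of FILE 94's constant: `Θ_w ≤ κ₀∕w` for `w ≥ 1` (`1∕w² ≤ 1∕w`). [folklore] -/
theorem rightRemainderConst_le {D Dr β β₁ cN cr E w : ℝ} (hw : 1 ≤ w) (hD : 0 ≤ D) (hβ : 0 ≤ β) :
    D * (3 * (β * (32 * π ^ 2 / w ^ 2)) + 2 * (β₁ * (π / w))) + 0 + β * ((π * Dr / w * E⁻¹ + 2 * (π * Dr / w)) * cN) * cr ≤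
      (D * (3 * (β * (32 * π ^ 2)) + 2 * (β₁ * π)) + β * ((π * Dr * E⁻¹ + 2 * (π * Dr)) * cN) * cr) / w := by
  have hw0 : 0 < w := by linarith
  have hc2 : 32 * π ^ 2 / w ^ 2 ≤ 32 * π ^ 2 / w := div_le_div_of_nonneg_left (by positivity) hw0 (by nlinarith)
  have h1 : D * (3 * (β * (32 * π ^ 2 / w ^ 2)) + 2 * (β₁ * (π / w))) ≤ D * (3 * (β * (32 * π ^ 2 / w)) + 2 * (β₁ * (π / w))) :=
    mul_le_mul_of_nonneg_left (add_le_add (mul_le_mul_of_nonneg_left (mul_le_mul_of_nonneg_left hc2 hβ) (by norm_num)) le_rfl) hD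
  calc D * (3 * (β * (32 * π ^ 2 / w ^ 2)) + 2 * (β₁ * (π / w))) + 0 + β * ((π * Dr / w * E⁻¹ + 2 * (π * Dr / w)) * cN) * cr
      ≤ D * (3 * (β * (32 * π ^ 2 / w)) + 2 * (β₁ * (π / w))) + 0 + β * ((π * Dr / w * E⁻¹ + 2 * (π * Dr / w)) * cN) * cr := by linarith
    _ = (D * (3 * (β * (32 * π ^ 2)) + 2 * (β₁ * π)) + β * ((π * Dr * E⁻¹ + 2 * (π * Dr)) * cN) * cr) / w := by
      field_simp
      ring

variable {L : ℕ} [NeZero L]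

/-- ★★★ **THE ADJOINT REMAINDER OF THE COVER's PARAMETRIX AT BOTH SPACINGS**: for odd `L ≥ 3`, `a > 0` there are `δ > 0`, `κ ≥ 0` with, for all `m`, `k ≥ 1`, `r`, on the doubled torus
`MP (paramsOf d L (m+1) k hL)` (cover `knitH`, `knitG` of FILE 70): `R̃ = remainderL Δ_a h G ≤ (κ∕L^m)·e^{−δ|y−y′|_T}` at the coarse spacing `L^{−k}` (King's unit blocks) AND at the fine
spacing `L^{−(k+r)}` (the pairing's blocks) — rows 7, 8 of FILE 50's `GluedLetters` for the glued `U ≡ 1` family, the `θ = κ₀∕M` slot with `M = L^m`.  FILE 94's cube rows fed with dag-n15-a's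
letters (`ineq110_114_pair` + `hasMaj_gOp_of_ineq`, N-IIn `hasMaj_rightGrad_pair` ∕ `hasMaj_rightBgrad_pair`, part 41 `hasMaj_landauRe`) at ONE rate, then FILE 94 `remainderL_cut` and FILE 57
`hasMaj_remainderL_out` (overlap `(2L)^{d+1}`, `|h| ≤ 1`); `Θ_w ≤ κ₀∕w` (`rightRemainderConst_le`).
[cite: Balaban1984PropagatorsII, (2.91)–(2.93) p.239, (2.134)–(2.135) p.247 (shapes + mechanism, transposed); Balaban1984PropagatorsI, Prop. 1.2 (1.110) p.35, (1.126) p.38, p.39] -/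
theorem hasMaj_remainderL_knit_pair (hL : Odd L ∧ 1 < L) {a : ℝ} (ha : 0 < a) :
    ∃ δ κ : ℝ, 0 < δ ∧ 0 ≤ κ ∧ ∀ (m kk r : ℕ) (_hk : 1 ≤ kk),
      HasMaj (BlockNorm.ofBlocks (unitTorusGeo L kk (MP (paramsOf d L (m + 1) kk hL)))
          (fun b : Tor (fine (L ^ kk) (MP (paramsOf d L (m + 1) kk hL))) × Fin (d + 1) => blockOf (L ^ kk) (MP (paramsOf d L (m + 1) kk hL)) b.1))
        (BlockNorm.ofBlocks (unitTorusGeo L kk (MP (paramsOf d L (m + 1) kk hL)))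
          (fun b : Tor (fine (L ^ kk) (MP (paramsOf d L (m + 1) kk hL))) × Fin (d + 1) => blockOf (L ^ kk) (MP (paramsOf d L (m + 1) kk hL)) b.1))
        (remainderL (deltaOp (MP (paramsOf d L (m + 1) kk hL)) (L ^ kk) a) (knitH d L m kk (L ^ kk) hL) (knitG d L m kk (L ^ kk) hL a))
        (fun y y' => κ / (L : ℝ) ^ m * Real.exp (-(δ * tdistT (MP (paramsOf d L (m + 1) kk hL)) y y'))) ∧
      HasMaj (BlockNorm.ofBlocks (unitTorusGeo L kk (MP (paramsOf d L (m + 1) kk hL)))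
          (fun x : Tor (fine (L ^ r * L ^ kk) (MP (paramsOf d L (m + 1) kk hL))) × Fin (d + 1) => blockOf (L ^ r * L ^ kk) (MP (paramsOf d L (m + 1) kk hL)) x.1))
        (BlockNorm.ofBlocks (unitTorusGeo L kk (MP (paramsOf d L (m + 1) kk hL)))
          (fun x : Tor (fine (L ^ r * L ^ kk) (MP (paramsOf d L (m + 1) kk hL))) × Fin (d + 1) => blockOf (L ^ r * L ^ kk) (MP (paramsOf d L (m + 1) kk hL)) x.1))
        (remainderL (deltaOp (MP (paramsOf d L (m + 1) kk hL)) (L ^ r * L ^ kk) a) (knitH d L m kk (L ^ r * L ^ kk) hL) (knitG d L m kk (L ^ r * L ^ kk) hL a))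
        (fun y y' => κ / (L : ℝ) ^ m * Real.exp (-(δ * tdistT (MP (paramsOf d L (m + 1) kk hL)) y y'))) := by
  have hL3 : 3 ≤ L := by obtain ⟨⟨j, hj⟩, h1⟩ := hL; omega
  have hLpos : 0 < L := by omega
  -- dag-n15-a's letters
  obtain ⟨δ₀, C, Cα, Cε, Cαε, hδ₀, hC, H⟩ := ineq110_114_pair (d := d) hL ha
  obtain ⟨δ₁, C₁, hδ₁, hC₁, HL⟩ := hasMaj_landauRe (d := d) (L := L)
  obtain ⟨δp, βp, hδp, hβp, HP⟩ := hasMaj_rightGrad_pair (d := d) hL ha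
  obtain ⟨δb, βb, hδb, hβb, HB⟩ := hasMaj_rightBgrad_pair (d := d) hL ha
  -- one rate for the cube's letters, one constant for its right entries
  have hδc : 0 < min δ₀ (min δp δb) := lt_min hδ₀ (lt_min hδp hδb)
  have hδc0 : min δ₀ (min δp δb) ≤ δ₀ := min_le_left _ _
  have hδcp : min δ₀ (min δp δb) ≤ δp := (min_le_right _ _).trans (min_le_left _ _)
  have hδcb : min δ₀ (min δp δb) ≤ δb := (min_le_right _ _).trans (min_le_right _ _)
  have hβc : 0 ≤ max βp βb := hβp.le.trans (le_max_left _ _)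
  have hδm : 0 < min (min δ₀ (min δp δb)) δ₁ := lt_min hδc hδ₁
  have hcr : 0 ≤ B4Sect5Proof.latticeConst (d + 1) (min (min δ₀ (min δp δb)) δ₁ / 4) := B4Sect5Proof.latticeConst_nonneg (d + 1) (by positivity)
  refine ⟨min (min δ₀ (min δp δb)) δ₁ / 2,
    (((2 * L) ^ (d + 1) : ℕ) : ℝ) *
      (((d + 1 : ℕ) : ℝ) * (3 * (2 ^ (d + 1) * (C * Real.exp (min δ₀ (min δp δb))) * (32 * π ^ 2)) + 2 * (max βp βb * π)) +
        2 ^ (d + 1) * (C * Real.exp (min δ₀ (min δp δb))) *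
          ((π * ((d : ℝ) + 1) * (Real.exp 1 * (min (min δ₀ (min δp δb)) δ₁ / 4))⁻¹ + 2 * (π * ((d : ℝ) + 1))) *
            (|a| * (Real.exp (min (min δ₀ (min δp δb)) δ₁) * Real.exp (min (min δ₀ (min δp δb)) δ₁)) + C₁)) *
          B4Sect5Proof.latticeConst (d + 1) (min (min δ₀ (min δp δb)) δ₁ / 4)),
    by positivity, by positivity, fun m kk r hk => ?_⟩
  -- the index's data
  have hM : ∀ ν, MP (paramsOf d L (m + 1) kk hL) ν = 2 * L * L ^ m := MP_succ_eq L m kk hL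
  have hw : 0 < L ^ m := pow_pos hLpos m
  have hn : 1 ≤ L ^ kk := Nat.one_le_pow _ _ hLpos
  have hn' : 1 ≤ L ^ r * L ^ kk := Nat.one_le_iff_ne_zero.mpr (Nat.mul_ne_zero (pow_ne_zero r (NeZero.ne L)) (pow_ne_zero kk (NeZero.ne L)))
  have hfit := coverMargin_fit hL3 m
  have hfit1 : coverMargin L m + 2 * L ^ m + 1 ≤ L * L ^ m := by omega
  have hS : L * L ^ m ≤ 2 * L * L ^ m := by rw [mul_assoc]; omega
  have hSe : L ^ (m + 1) = L * L ^ m := by rw [pow_succ, mul_comm]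
  have hwR : (1 : ℝ) ≤ ((L ^ m : ℕ) : ℝ) := by exact_mod_cast hw
  have hwcast : ((L ^ m : ℕ) : ℝ) = (L : ℝ) ^ m := Nat.cast_pow L m
  -- torus letters at both spacings, weakened to the common rate
  have Hk := (H (m + 1) kk r hk).1
  have Hk' := (H (m + 1) kk r hk).2
  have hG := (hasMaj_gOp_of_ineq (L := L) (k := kk) (MP (paramsOf d L (m + 1) kk hL)) (L ^ kk) a hn Hk hC.le).mono fun y y' => maj₀_weaken le_rfl hC.le hδc0 y y'
  have hG' := (hasMaj_gOp_of_ineq (L := L) (k := kk) (MP (paramsOf d L (m + 1) kk hL)) (L ^ r * L ^ kk) a hn' Hk' hC.le).mono fun y y' => maj₀_weaken le_rfl hC.le hδc0 y y'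
  have hNL := HL kk (L ^ kk) (MP (paramsOf d L (m + 1) kk hL))
  have hNL' := HL kk (L ^ r * L ^ kk) (MP (paramsOf d L (m + 1) kk hL))
  -- the cubes' adjoint rows at both spacings (FILE 94)
  have hK : ∀ k : Fin (d + 1) → ZMod (2 * L),
      HasMaj (BlockNorm.ofBlocks (unitTorusGeo L kk (MP (paramsOf d L (m + 1) kk hL)))
          (fun b : Tor (fine (L ^ kk) (MP (paramsOf d L (m + 1) kk hL))) × Fin (d + 1) => blockOf (L ^ kk) (MP (paramsOf d L (m + 1) kk hL)) b.1))
        (BlockNorm.ofBlocks (unitTorusGeo L kk (MP (paramsOf d L (m + 1) kk hL)))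
          (fun b : Tor (fine (L ^ kk) (MP (paramsOf d L (m + 1) kk hL))) × Fin (d + 1) => blockOf (L ^ kk) (MP (paramsOf d L (m + 1) kk hL)) b.1))
        ((mulOp (chiCube (MP (paramsOf d L (m + 1) kk hL)) (L ^ kk) (coverCorner (MP (paramsOf d L (m + 1) kk hL)) (L ^ m) L (coverMargin L m) k) (L * L ^ m)) ∘ₗ
          knitG d L m kk (L ^ kk) hL a k) ∘ₗ commOp (deltaOp (MP (paramsOf d L (m + 1) kk hL)) (L ^ kk) a) (knitH d L m kk (L ^ kk) hL k))
        (fun y y' => ind ((cubeBlocks (MP (paramsOf d L (m + 1) kk hL)) (coverCorner (MP (paramsOf d L (m + 1) kk hL)) (L ^ m) L (coverMargin L m) k) (L * L ^ m) : Finset _) : Set _) y *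
          ((((d + 1 : ℕ) : ℝ) * (3 * (2 ^ (d + 1) * (C * Real.exp (min δ₀ (min δp δb))) * (32 * π ^ 2 / ((L ^ m : ℕ) : ℝ) ^ 2)) + 2 * (max βp βb * (π / ((L ^ m : ℕ) : ℝ)))) + 0 +
            2 ^ (d + 1) * (C * Real.exp (min δ₀ (min δp δb))) *
              ((π * (d + 1) / ((L ^ m : ℕ) : ℝ) * (Real.exp 1 * (min (min δ₀ (min δp δb)) δ₁ / 4))⁻¹ + 2 * (π * (d + 1) / ((L ^ m : ℕ) : ℝ))) *
                (|a| * (Real.exp (min (min δ₀ (min δp δb)) δ₁) * Real.exp (min (min δ₀ (min δp δb)) δ₁)) + C₁)) *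
              B4Sect5Proof.latticeConst (d + 1) (min (min δ₀ (min δp δb)) δ₁ / 4)) *
            Real.exp (-(min (min δ₀ (min δp δb)) δ₁ / 2 * tdistT (MP (paramsOf d L (m + 1) kk hL)) y y')))) := fun k => by
    have hTD : ∀ μ : Fin (d + 1), _ := fun μ => by
      have h := (HP (m + 1) kk r hk (coverCorner (MP (paramsOf d L (m + 1) kk hL)) (L ^ m) L (coverMargin L m) k) μ).1
      rw [hSe, symbOp_sD_eq] at h
      exact h.mono fun y y' => maj₂_weaken (le_max_left βp βb) hβc hδcp y y'
    have hTB : ∀ μ : Fin (d + 1), _ := fun μ => by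
      have h := (HB (m + 1) kk r hk (coverCorner (MP (paramsOf d L (m + 1) kk hL)) (L ^ m) L (coverMargin L m) k) μ).1
      rw [hSe, symbOp_sTinv_sub_one_eq] at h
      exact h.mono fun y y' => maj₂_weaken (le_max_right βp βb) hβc hδcb y y'
    exact hasMaj_chiCube_neumannCubeG_comp_commOp_deltaOp (L := L) (kk := kk) (n := L ^ kk) (q := L) (w := L ^ m) (m₀ := coverMargin L m) hM hw hfit1 k ha hC hδc hC₁.le
      hδ₁ hβc hG hTD hTB hNL
  have hK' : ∀ k : Fin (d + 1) → ZMod (2 * L),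
      HasMaj (BlockNorm.ofBlocks (unitTorusGeo L kk (MP (paramsOf d L (m + 1) kk hL)))
          (fun x : Tor (fine (L ^ r * L ^ kk) (MP (paramsOf d L (m + 1) kk hL))) × Fin (d + 1) => blockOf (L ^ r * L ^ kk) (MP (paramsOf d L (m + 1) kk hL)) x.1))
        (BlockNorm.ofBlocks (unitTorusGeo L kk (MP (paramsOf d L (m + 1) kk hL)))
          (fun x : Tor (fine (L ^ r * L ^ kk) (MP (paramsOf d L (m + 1) kk hL))) × Fin (d + 1) => blockOf (L ^ r * L ^ kk) (MP (paramsOf d L (m + 1) kk hL)) x.1))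
        ((mulOp (chiCube (MP (paramsOf d L (m + 1) kk hL)) (L ^ r * L ^ kk) (coverCorner (MP (paramsOf d L (m + 1) kk hL)) (L ^ m) L (coverMargin L m) k) (L * L ^ m)) ∘ₗ
          knitG d L m kk (L ^ r * L ^ kk) hL a k) ∘ₗ commOp (deltaOp (MP (paramsOf d L (m + 1) kk hL)) (L ^ r * L ^ kk) a) (knitH d L m kk (L ^ r * L ^ kk) hL k))
        (fun y y' => ind ((cubeBlocks (MP (paramsOf d L (m + 1) kk hL)) (coverCorner (MP (paramsOf d L (m + 1) kk hL)) (L ^ m) L (coverMargin L m) k) (L * L ^ m) : Finset _) : Set _) y *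
          ((((d + 1 : ℕ) : ℝ) * (3 * (2 ^ (d + 1) * (C * Real.exp (min δ₀ (min δp δb))) * (32 * π ^ 2 / ((L ^ m : ℕ) : ℝ) ^ 2)) + 2 * (max βp βb * (π / ((L ^ m : ℕ) : ℝ)))) + 0 +
            2 ^ (d + 1) * (C * Real.exp (min δ₀ (min δp δb))) *
              ((π * (d + 1) / ((L ^ m : ℕ) : ℝ) * (Real.exp 1 * (min (min δ₀ (min δp δb)) δ₁ / 4))⁻¹ + 2 * (π * (d + 1) / ((L ^ m : ℕ) : ℝ))) *
                (|a| * (Real.exp (min (min δ₀ (min δp δb)) δ₁) * Real.exp (min (min δ₀ (min δp δb)) δ₁)) + C₁)) *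
              B4Sect5Proof.latticeConst (d + 1) (min (min δ₀ (min δp δb)) δ₁ / 4)) *
            Real.exp (-(min (min δ₀ (min δp δb)) δ₁ / 2 * tdistT (MP (paramsOf d L (m + 1) kk hL)) y y')))) := fun k => by
    have hTD : ∀ μ : Fin (d + 1), _ := fun μ => by
      have h := (HP (m + 1) kk r hk (coverCorner (MP (paramsOf d L (m + 1) kk hL)) (L ^ m) L (coverMargin L m) k) μ).2
      rw [hSe, symbOp_sD_eq] at h
      exact h.mono fun y y' => maj₂_weaken (le_max_left βp βb) hβc hδcp y y'
    have hTB : ∀ μ : Fin (d + 1), _ := fun μ => by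
      have h := (HB (m + 1) kk r hk (coverCorner (MP (paramsOf d L (m + 1) kk hL)) (L ^ m) L (coverMargin L m) k) μ).2
      rw [hSe, symbOp_sTinv_sub_one_eq] at h
      exact h.mono fun y y' => maj₂_weaken (le_max_right βp βb) hβc hδcb y y'
    exact hasMaj_chiCube_neumannCubeG_comp_commOp_deltaOp (L := L) (kk := kk) (n := L ^ r * L ^ kk) (q := L) (w := L ^ m) (m₀ := coverMargin L m) hM hw hfit1 k ha hC
      hδc hC₁.le hδ₁ hβc hG' hTD hTB hNL'
  -- the cut does not see `R̃`; sum over the cover (output overlap `(2L)^{d+1}`, `|h| ≤ 1`)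
  have hcut : ∀ k : Fin (d + 1) → ZMod (2 * L), mulOp (knitH d L m kk (L ^ kk) hL k) ∘ₗ
      mulOp (chiCube (MP (paramsOf d L (m + 1) kk hL)) (L ^ kk) (coverCorner (MP (paramsOf d L (m + 1) kk hL)) (L ^ m) L (coverMargin L m) k) (L * L ^ m)) =
      mulOp (knitH d L m kk (L ^ kk) hL k) := fun k =>
    hcube_cut (2 * L) (coverXi (MP (paramsOf d L (m + 1) kk hL)) (L ^ kk) (L ^ m)) (bshiftEquiv (MP (paramsOf d L (m + 1) kk hL)) (L ^ kk)) 0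
      (chiCube_coverCorner_eq_one_side (M := MP (paramsOf d L (m + 1) kk hL)) (n := L ^ kk) (m₀ := coverMargin L m) hM hw hfit1 hS 0 k)
  have hcut' : ∀ k : Fin (d + 1) → ZMod (2 * L), mulOp (knitH d L m kk (L ^ r * L ^ kk) hL k) ∘ₗ
      mulOp (chiCube (MP (paramsOf d L (m + 1) kk hL)) (L ^ r * L ^ kk) (coverCorner (MP (paramsOf d L (m + 1) kk hL)) (L ^ m) L (coverMargin L m) k) (L * L ^ m)) =
      mulOp (knitH d L m kk (L ^ r * L ^ kk) hL k) := fun k =>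
    hcube_cut (2 * L) (coverXi (MP (paramsOf d L (m + 1) kk hL)) (L ^ r * L ^ kk) (L ^ m)) (bshiftEquiv (MP (paramsOf d L (m + 1) kk hL)) (L ^ r * L ^ kk)) 0
      (chiCube_coverCorner_eq_one_side (M := MP (paramsOf d L (m + 1) kk hL)) (n := L ^ r * L ^ kk) (m₀ := coverMargin L m) hM hw hfit1 hS 0 k)
  have hh : ∀ (k : Fin (d + 1) → ZMod (2 * L)) x, |knitH d L m kk (L ^ kk) hL k x| ≤ 1 := fun k x => abs_coverH_le_one k x
  have hh' : ∀ (k : Fin (d + 1) → ZMod (2 * L)) x', |knitH d L m kk (L ^ r * L ^ kk) hL k x'| ≤ 1 := fun k x' => abs_coverH_le_one k x'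
  have hN := fun y => sum_ind_cubeBlocks_le (M := MP (paramsOf d L (m + 1) kk hL)) (w := L ^ m) (q := L) (m₀ := coverMargin L m) L kk y
  have hΘ := rightRemainderConst_le (D := ((d + 1 : ℕ) : ℝ)) (Dr := (d : ℝ) + 1) (β := 2 ^ (d + 1) * (C * Real.exp (min δ₀ (min δp δb)))) (β₁ := max βp βb)
    (cN := |a| * (Real.exp (min (min δ₀ (min δp δb)) δ₁) * Real.exp (min (min δ₀ (min δp δb)) δ₁)) + C₁) (cr := B4Sect5Proof.latticeConst (d + 1) (min (min δ₀ (min δp δb)) δ₁ / 4))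
    (E := Real.exp 1 * (min (min δ₀ (min δp δb)) δ₁ / 4)) hwR (by positivity) (by positivity)
  have hΘ0 : (0 : ℝ) ≤ ((d + 1 : ℕ) : ℝ) * (3 * (2 ^ (d + 1) * (C * Real.exp (min δ₀ (min δp δb))) * (32 * π ^ 2 / ((L ^ m : ℕ) : ℝ) ^ 2)) + 2 * (max βp βb * (π / ((L ^ m : ℕ) : ℝ)))) + 0 +
      2 ^ (d + 1) * (C * Real.exp (min δ₀ (min δp δb))) *
        ((π * (d + 1) / ((L ^ m : ℕ) : ℝ) * (Real.exp 1 * (min (min δ₀ (min δp δb)) δ₁ / 4))⁻¹ + 2 * (π * (d + 1) / ((L ^ m : ℕ) : ℝ))) *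
          (|a| * (Real.exp (min (min δ₀ (min δp δb)) δ₁) * Real.exp (min (min δ₀ (min δp δb)) δ₁)) + C₁)) *
        B4Sect5Proof.latticeConst (d + 1) (min (min δ₀ (min δp δb)) δ₁ / 4) := by positivity
  have hNov : (0 : ℝ) ≤ (((2 * L) ^ (d + 1) : ℕ) : ℝ) := by positivity
  have hR := hasMaj_remainderL_out (g := unitTorusGeo L kk (MP (paramsOf d L (m + 1) kk hL)))
    (fun b : Tor (fine (L ^ kk) (MP (paramsOf d L (m + 1) kk hL))) × Fin (d + 1) => blockOf (L ^ kk) (MP (paramsOf d L (m + 1) kk hL)) b.1)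
    (fun k => ((cubeBlocks (MP (paramsOf d L (m + 1) kk hL)) (coverCorner (MP (paramsOf d L (m + 1) kk hL)) (L ^ m) L (coverMargin L m) k) (L * L ^ m) : Finset _) : Set _))
    (Δ := deltaOp (MP (paramsOf d L (m + 1) kk hL)) (L ^ kk) a) (h := knitH d L m kk (L ^ kk) hL)
    (G := fun k => mulOp (chiCube (MP (paramsOf d L (m + 1) kk hL)) (L ^ kk) (coverCorner (MP (paramsOf d L (m + 1) kk hL)) (L ^ m) L (coverMargin L m) k) (L * L ^ m)) ∘ₗ
      knitG d L m kk (L ^ kk) hL a k) hΘ0 hh hN hK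
  have hR' := hasMaj_remainderL_out (g := unitTorusGeo L kk (MP (paramsOf d L (m + 1) kk hL)))
    (fun x : Tor (fine (L ^ r * L ^ kk) (MP (paramsOf d L (m + 1) kk hL))) × Fin (d + 1) => blockOf (L ^ r * L ^ kk) (MP (paramsOf d L (m + 1) kk hL)) x.1)
    (fun k => ((cubeBlocks (MP (paramsOf d L (m + 1) kk hL)) (coverCorner (MP (paramsOf d L (m + 1) kk hL)) (L ^ m) L (coverMargin L m) k) (L * L ^ m) : Finset _) : Set _))
    (Δ := deltaOp (MP (paramsOf d L (m + 1) kk hL)) (L ^ r * L ^ kk) a) (h := knitH d L m kk (L ^ r * L ^ kk) hL)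
    (G := fun k => mulOp (chiCube (MP (paramsOf d L (m + 1) kk hL)) (L ^ r * L ^ kk) (coverCorner (MP (paramsOf d L (m + 1) kk hL)) (L ^ m) L (coverMargin L m) k) (L * L ^ m)) ∘ₗ
      knitG d L m kk (L ^ r * L ^ kk) hL a k) hΘ0 hh' hN hK'
  rw [remainderL_cut hcut] at hR
  rw [remainderL_cut hcut'] at hR'
  have key := mul_le_mul_of_nonneg_left hΘ hNov
  refine ⟨hR.mono fun y y' => ?_, hR'.mono fun y y' => ?_⟩ <;>
  · rw [← hwcast]
    exact mul_le_mul_of_nonneg_right (key.trans_eq (mul_div_assoc _ _ _).symm) (Real.exp_nonneg _)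

end Knit

end Summit.QuantumFields.YangMills.BalabanUVNodes.N15.Gluing

end
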